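import Literature.Analysis.ODE.LogConvexityBackwardUniqueness
import Mathlib.Analysis.InnerProductSpace.Calculus
import Mathlib.Analysis.InnerProductSpace.Continuous
import Mathlib.Analysis.Calculus.Deriv.Slope
import Mathlib.Analysis.SpecialFunctions.Sqrt
import HarnessLib

/-!
# Backward uniqueness for the abstract parabolic equation `u' + Au = f` in a Hilbert space
# (Kukavica 2007, Thm. 2.1, classical case; Temam 1997, Ch. III Lemma 6.2; Bardos–Tartar 1973)

Analysis/ODE proof file (theorems only: no definition, no named fact). It lifts the tree's
real-variable log-convexity lemma `Literature.Analysis.ODE.eq_zero_of_dirichletQuotient_law`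
(`LogConvexityBackwardUniqueness.lean`: Temam's Lemma 6.2 for two real functions `E`, `V`) to the
printed ABSTRACT statement about a trajectory in an inner-product space.

Source followed: I. Kukavica, *Log-log convexity and backward uniqueness*, Proc. Amer. Math. Soc.
135 (2007) 2415–2421, **§2, Theorem 2.1** (p. 2417) in its *classical case* `α = β = 0`, `β₀ = 1`
(p. 2417: "Note that the classical case corresponds to `β = 0`, `β₀ = 1`, `α = 0`"), which is the
log-convexity backward uniqueness theorem of Ogawa 1965, Bardos–Tartar 1973 (Thm. II.1),
Ghidaglia 1986 and Temam 1997, Ch. III §6.1, Lemma 6.2 (Remark 6.1 there). Printed setting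
(p. 2416): "Let `H` be a real or complex Hilbert space … Let `A` be a symmetric operator with the
domain `D(A) ⊆ H`. Assume that `(Au, u) ≥ 0` for `u ∈ D(A)`. Let
`u ∈ C([T₀, 0], D(A)) ∩ C¹([T₀, 0], H)` be a solution of `u' + Au = f` with `f ∈ C([T₀, 0], H)`,
where the requirement `u ∈ C([T₀, 0], D(A))` means `Au ∈ C([T₀, 0], H)` … it will be convenient
to use the notation `‖A^{1/2}v‖ = (Av, v)^{1/2}`." Assumption (1) in the classical case reads
`‖f‖ ≤ K₁‖A^{1/2}u‖ + K₂‖u‖`, and (2) (`Re(f, u) ≥ -K₃‖u‖‖A^{1/2}u‖ - K₄‖u‖²`) then follows from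
(1) by the Cauchy–Schwarz inequality. **Theorem 2.1**: "Let `u : [T₀, 0] → H` be as above. Then
`u(0) = 0` implies `u(t) = 0` for all `t ∈ [T₀, 0]`." The printed proof (p. 2417) rests on the two
identities (4): `½ d/dt (u, u) = -(Au, u) + Re(f, u)` and `½ d/dt (Au, u) = -(Au, Au) + Re(f, Au)`
("Note that our assumptions imply (4)"), and on the Dirichlet-quotient identity (5)
`½Q' + ‖(A - Q)w‖² = Re(f/‖u‖, (A - Q)w)`, `w = u/‖u‖`, `Q = ‖A^{1/2}u‖²/‖u‖²` ([CFNT, G]).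

## Rendering and proof

* `H` is a real inner-product space (completeness is never used); the domain is a submodule
  `D : Submodule ℝ H` and `A : D →ₗ[ℝ] H` is symmetric (`⟪Ax, y⟫ = ⟪x, Ay⟫` on `D`) and
  non-negative; the trajectory is `u : ℝ → D`; the time interval is any `[a, b]` (printed:
  `[T₀, 0]`) with ONE-SIDED derivatives within `[a, b]` (`HasDerivWithinAt … (Icc a b) t`, which is
  what `C¹([T₀, 0], H)` provides at the end points) and `t ↦ A(u t)` continuous on `[a, b]`
  (= `u ∈ C([T₀, 0], D(A))`). Continuity of `f` is not needed and not assumed.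
* Identity (4), second half, is `hasDerivWithinAt_inner_symm_apply`: for symmetric `A`,
  `⟪Au(τ), u(τ)⟫ - ⟪Au(t), u(t)⟫ = ⟪Au(τ), u(τ) - u(t)⟫ + ⟪u(τ) - u(t), Au(t)⟫`, so only the
  differentiability of `u` and the continuity of `Au` enter (no differentiability of `Au`).
* With `E = ‖u‖²`, `V = ⟪Au, u⟫`, `E' = -2V + 2⟪u, f⟫`, `V' = -2‖Au‖² + 2⟪Au, f⟫`, identity (5)
  multiplied by `E² = ‖u‖⁴` reads `V'E - VE' = E(-2‖z‖² + 2⟪z, f⟫)`, `z = Au - (V/E)u`, whence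
  `V'E - VE' ≤ E‖f‖²/2 ≤ (K₁² + K₂²)(V + E)E` and `E' ≥ -((2 + K₁)V + (K₁ + 2K₂)E)`; these are
  exactly the two hypotheses of `eq_zero_of_dirichletQuotient_law`.
* A harmless generalisation useful for incompressible flows is proved first
  (`eq_zero_of_abstractParabolic_backward_of_orthogonal`): the right-hand side may carry an extra
  term `p(t)` orthogonal to `u(t)` and to `Au(t)` (a pressure gradient against a divergence-free
  field and its Laplacian), on which no bound is imposed — the printed computation only pairs the
  right-hand side with `u` and `Au`. The printed statement is the case `p = 0`
  (`eq_zero_of_abstractParabolic_backward`). Also recorded: the two-solution form of Temam's §6.2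
  (6.16) (`eq_of_abstractParabolic_backward`), the forward "no extinction" reading
  (`ne_zero_of_abstractParabolic`), and Ghidaglia's squared form of the hypothesis
  `‖f‖² ≤ K(⟪Au, u⟫ + ‖u‖²)` (`eq_zero_of_abstractParabolic_backward_of_sq`).

What is NOT here: the log-log (`α > 0`) and sublinear (`β > 0`) cases of Kukavica's Thm. 2.1,
time-dependent `Kᵢ ∈ L²` (Remark 2.2; Temam's `k ∈ L²(0, T)` in (6.7)), and the complex case
(`TODO(general form)`: `RCLike 𝕜` scalars with `Re ⟪·, ·⟫`). The whole-space Navier–Stokes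
rendering with classical fields is `Literature.Analysis.FluidPDE.IsClassicalNSSolutionOn.backward_unique`
(`FluidPDE/BackwardEnergyUniqueness.lean`).

## Mathlib / tree search

Tree: `eq_zero_of_dirichletQuotient_law`, `pos_of_dirichletQuotient_law` (the real-variable core,
reused here); `lean search 'abstractParabolic|inner_symm_apply|Kukavica2007'`: nothing else
(2026-08-27). Mathlib: `hasDerivWithinAt_iff_tendsto_slope`, `Filter.Tendsto.inner`,
`HasDerivWithinAt.norm_sq`, `norm_sub_sq_real`, `real_inner_le_norm`, `abs_real_inner_le_norm`.

## References

* I. Kukavica, *Log-log convexity and backward uniqueness*, Proc. Amer. Math. Soc. 135 (2007),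
  no. 8, 2415–2421, §2 Thm. 2.1, identities (4), (5). [Kukavica2007]
* R. Temam, *Infinite-Dimensional Dynamical Systems in Mechanics and Physics*, 2nd ed., Springer
  1997, Ch. III §6.1, Lemmas 6.1–6.2, Remark 6.1; §6.2 (6.16)–(6.17). [Temam1997]
* C. Bardos, L. Tartar, *Sur l'unicité rétrograde des équations paraboliques et quelques questions
  voisines*, Arch. Rational Mech. Anal. 50 (1973) 10–25, Thm. II.1 (as cited in [Kukavica2007],
  ref. [BT], and [Temam1997], Remark 6.1). [BardosTartar1973]
-/

noncomputable section

open Set Filter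
open _root_.Topology

open scoped RealInnerProductSpace

namespace Literature.Analysis.ODE

variable {H : Type*} [NormedAddCommGroup H] [InnerProductSpace ℝ H]

/-! ### §1. Identity (4): the derivative of the Dirichlet form along a trajectory -/

/-- **Kukavica 2007, identity (4), second half** (`½ d/dt (Au, u) = Re(u_t, Au)`): for a
symmetric operator `A` on a domain `D ⊆ H` and a trajectory `u` in `D`, differentiable at `t`
within `s` as an `H`-valued map with derivative `u'`, and such that `τ ↦ A(u τ)` is continuous at
`t` within `s`, the Dirichlet form `τ ↦ ⟪A(u τ), u τ⟫` is differentiable at `t` within `s` with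
derivative `2⟪A(u t), u'⟫`. (By symmetry,
`⟪Au(τ), u(τ)⟫ - ⟪Au(t), u(t)⟫ = ⟪Au(τ), u(τ) - u(t)⟫ + ⟪u(τ) - u(t), Au(t)⟫`; no
differentiability of `Au` is needed.) [cite: Kukavica2007, §2, identity (4) (p. 2417)] -/
theorem hasDerivWithinAt_inner_symm_apply {D : Submodule ℝ H} (A : D →ₗ[ℝ] H)
    (hsym : ∀ x y : D, ⟪A x, (y : H)⟫ = ⟪(x : H), A y⟫) {u : ℝ → D} {u' : H} {s : Set ℝ} {t : ℝ}
    (hu : HasDerivWithinAt (fun τ => (u τ : H)) u' s t)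
    (hA : ContinuousWithinAt (fun τ => A (u τ)) s t) :
    HasDerivWithinAt (fun τ => ⟪A (u τ), (u τ : H)⟫) (2 * ⟪A (u t), u'⟫) s t := by
  rw [hasDerivWithinAt_iff_tendsto_slope] at hu ⊢
  have key : ∀ τ, slope (fun τ => ⟪A (u τ), (u τ : H)⟫) t τ =
      ⟪A (u τ), slope (fun τ => (u τ : H)) t τ⟫ + ⟪slope (fun τ => (u τ : H)) t τ, A (u t)⟫ := by
    intro τ
    have hs : ⟪A (u τ) - A (u t), (u t : H)⟫ = ⟪(u τ : H) - (u t : H), A (u t)⟫ := by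
      rw [← map_sub, hsym, Submodule.coe_sub]
    simp only [slope, vsub_eq_sub, smul_eq_mul, real_inner_smul_right, real_inner_smul_left]
    have e : ⟪A (u τ), (u τ : H)⟫ - ⟪A (u t), (u t : H)⟫ =
        ⟪A (u τ), (u τ : H) - (u t : H)⟫ + ⟪(u τ : H) - (u t : H), A (u t)⟫ := by
      rw [← hs, inner_sub_right, inner_sub_left]; ring
    rw [e]; ring
  have hA' : Tendsto (fun τ => A (u τ)) (𝓝[s \ {t}] t) (𝓝 (A (u t))) :=
    (hA.mono fun _ hx => hx.1).tendsto
  have hc : Tendsto (fun _ : ℝ => A (u t)) (𝓝[s \ {t}] t) (𝓝 (A (u t))) := tendsto_const_nhds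
  have h := (hA'.inner (𝕜 := ℝ) hu).add (hu.inner (𝕜 := ℝ) hc)
  have e2 : ⟪A (u t), u'⟫ + ⟪u', A (u t)⟫ = 2 * ⟪A (u t), u'⟫ := by
    rw [real_inner_comm (A (u t)) u']; ring
  rw [e2] at h
  exact h.congr fun τ => (key τ).symm

/-! ### §2. The two real inequalities fed to the log-convexity lemma -/

/-- Energy side (Temam's (6.14); Kukavica's (8) with `α = 0`, `β₀ = 1`): with `n = ‖u‖`,
`s = ‖A^{1/2}u‖` (`s² = V`), `‖f‖ ≤ K₁s + K₂n` and `⟪u, f⟫ ≥ -n‖f‖`,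
`E' = -2V + 2⟪u, f⟫ ≥ -((2 + K₁)V + (K₁ + 2K₂)n²)`. [cite: Kukavica2007, §2, proof of Thm. 2.1, (8) (p. 2418)] -/
private theorem low_aux {V n s F IU K₁ K₂ : ℝ} (hK₁ : 0 ≤ K₁) (hn : 0 ≤ n)
    (hs2 : s ^ 2 = V) (hF : F ≤ K₁ * s + K₂ * n) (hIU : -(n * F) ≤ IU) :
    -((2 + K₁) * V + (K₁ + 2 * K₂) * n ^ 2) ≤ -2 * V + 2 * IU := by
  have h1 : n * F ≤ n * (K₁ * s + K₂ * n) := mul_le_mul_of_nonneg_left hF hn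
  have h2 : 2 * (n * s) ≤ n ^ 2 + s ^ 2 := by nlinarith [sq_nonneg (n - s)]
  have h3 : K₁ * (2 * (n * s)) ≤ K₁ * (n ^ 2 + s ^ 2) := mul_le_mul_of_nonneg_left h2 hK₁
  nlinarith [h1, h3, hIU, hs2]

/-- Dirichlet-quotient side (Kukavica's identity (5) = Temam's Lemma 6.1, cleared of denominators):
with `ΛE = V`, `m = ‖Au - Λu‖` (`m² = ‖Au‖² - 2ΛV + Λ²E`), `j = ⟪Au - Λu, f⟫ = ⟪Au, f⟫ - Λ⟪u, f⟫ ≤ m‖f‖`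
and `‖f‖ ≤ K₁s + K₂n` (`s² = V`, `n² = E`):
`V'E - VE' = E(-2m² + 2j) ≤ E‖f‖²/2 ≤ (K₁² + K₂²)(V + E)E`. [cite: Kukavica2007, §2, identity (5) (p. 2417)] -/
private theorem quot_aux {E V Λ m j F s n NA IA IU K₁ K₂ : ℝ} (hE : 0 < E) (hΛ : Λ * E = V)
    (hm2 : m ^ 2 = NA - 2 * Λ * V + Λ ^ 2 * E) (hj : j = IA - Λ * IU)
    (hjm : j ≤ m * F) (hF0 : 0 ≤ F) (hF : F ≤ K₁ * s + K₂ * n)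
    (hs2 : s ^ 2 = V) (hn2 : n ^ 2 = E) (hV : 0 ≤ V) :
    (-2 * NA + 2 * IA) * E - V * (-2 * V + 2 * IU) ≤ (K₁ ^ 2 + K₂ ^ 2) * (V + E) * E := by
  have h1 : (-2 * NA + 2 * IA) * E - V * (-2 * V + 2 * IU) = E * (-2 * m ^ 2 + 2 * j) := by
    subst hΛ; rw [hj, hm2]; ring
  have h2 : -2 * m ^ 2 + 2 * j ≤ F ^ 2 / 2 := by nlinarith [hjm, sq_nonneg (m - F / 2)]
  have hF2 : F ^ 2 ≤ (K₁ * s + K₂ * n) ^ 2 := pow_le_pow_left₀ hF0 hF 2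
  have h3 : F ^ 2 / 2 ≤ K₁ ^ 2 * V + K₂ ^ 2 * E := by
    rw [← hs2, ← hn2]; nlinarith [hF2, sq_nonneg (K₁ * s - K₂ * n)]
  have h4 : K₁ ^ 2 * V + K₂ ^ 2 * E ≤ (K₁ ^ 2 + K₂ ^ 2) * (V + E) := by
    nlinarith [mul_nonneg (sq_nonneg K₁) hE.le, mul_nonneg (sq_nonneg K₂) hV]
  rw [h1]
  calc E * (-2 * m ^ 2 + 2 * j) ≤ E * ((K₁ ^ 2 + K₂ ^ 2) * (V + E)) :=
        mul_le_mul_of_nonneg_left (h2.trans (h3.trans h4)) hE.le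
    _ = (K₁ ^ 2 + K₂ ^ 2) * (V + E) * E := by ring

/-! ### §3. Theorem 2.1 (classical case) -/

/-- **Backward uniqueness for `u' + Au = f + p` with `p ⟂ u`, `p ⟂ Au`** (Kukavica 2007, Thm. 2.1,
classical case `α = β = 0`, `β₀ = 1`, with an extra right-hand term orthogonal to the trajectory
and to `Au`, on which nothing else is assumed — e.g. a pressure gradient against a divergence-free
field and its Laplacian; the printed computation pairs the right-hand side only with `u` and `Au`).
Let `A : D → H` be symmetric and non-negative on a submodule `D` of a real inner-product space `H`,
`u : [a, b] → D` with one-sided `H`-derivative `u'` within `[a, b]`, `t ↦ A(u t)` continuous on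
`[a, b]`, `u' + Au = f + p` with `‖f‖ ≤ K₁⟪Au, u⟫^{1/2} + K₂‖u‖` (`K₁ ≥ 0`), `⟪p, u⟫ = ⟪p, Au⟫ = 0`.
If `u(b) = 0` then `u ≡ 0` on `[a, b]`. Proof: `E = ‖u‖²`, `V = ⟪Au, u⟫` satisfy the hypotheses of
`eq_zero_of_dirichletQuotient_law` with `α = 2 + K₁`, `β = K₁ + 2K₂`, `K = K₁² + K₂²`.
[cite: Kukavica2007, §2 Thm. 2.1 (p. 2417), classical case] -/
theorem eq_zero_of_abstractParabolic_backward_of_orthogonal {D : Submodule ℝ H} (A : D →ₗ[ℝ] H)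
    (hsym : ∀ x y : D, ⟪A x, (y : H)⟫ = ⟪(x : H), A y⟫) (hpos : ∀ x : D, 0 ≤ ⟪A x, (x : H)⟫)
    {a b K₁ K₂ : ℝ} (hK₁ : 0 ≤ K₁) {u : ℝ → D} {u' f p : ℝ → H}
    (hu : ∀ t ∈ Icc a b, HasDerivWithinAt (fun τ => (u τ : H)) (u' t) (Icc a b) t)
    (hAu : ContinuousOn (fun t => A (u t)) (Icc a b))
    (heq : ∀ t ∈ Icc a b, u' t + A (u t) = f t + p t)
    (hf : ∀ t ∈ Icc a b, ‖f t‖ ≤ K₁ * Real.sqrt ⟪A (u t), (u t : H)⟫ + K₂ * ‖(u t : H)‖)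
    (hpu : ∀ t ∈ Icc a b, ⟪p t, (u t : H)⟫ = 0) (hpA : ∀ t ∈ Icc a b, ⟪p t, A (u t)⟫ = 0)
    (hb : u b = 0) {t₀ : ℝ} (ht₀ : t₀ ∈ Icc a b) : u t₀ = 0 := by
  set E : ℝ → ℝ := fun t => ‖(u t : H)‖ ^ 2 with hE_def
  set V : ℝ → ℝ := fun t => ⟪A (u t), (u t : H)⟫ with hV_def
  set E' : ℝ → ℝ := fun t => 2 * ⟪(u t : H), u' t⟫ with hE'_def
  set V' : ℝ → ℝ := fun t => 2 * ⟪A (u t), u' t⟫ with hV'_def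
  have hE : ∀ t ∈ Icc a b, HasDerivWithinAt E (E' t) (Icc a b) t := fun t ht =>
    (hu t ht).norm_sq
  have hV : ∀ t ∈ Icc a b, HasDerivWithinAt V (V' t) (Icc a b) t := fun t ht =>
    hasDerivWithinAt_inner_symm_apply A hsym (hu t ht) (hAu t ht)
  have hE0 : ∀ t ∈ Icc a b, 0 ≤ E t := fun t _ => sq_nonneg _
  have hV0 : ∀ t ∈ Icc a b, 0 ≤ V t := fun t _ => hpos (u t)
  have hu' : ∀ t ∈ Icc a b, u' t = f t + p t - A (u t) := fun t ht => by
    rw [← heq t ht]; abel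
  -- identity (4): `E' = -2V + 2⟪u, f⟫`, `V' = -2‖Au‖² + 2⟪Au, f⟫`
  have hE'eq : ∀ t ∈ Icc a b, E' t = -2 * V t + 2 * ⟪(u t : H), f t⟫ := by
    intro t ht
    have hp' : ⟪(u t : H), p t⟫ = 0 := by rw [real_inner_comm]; exact hpu t ht
    have hAu' : ⟪(u t : H), A (u t)⟫ = V t := by rw [hV_def, real_inner_comm]
    simp only [hE'_def, hu' t ht, inner_add_right, inner_sub_right, hp', hAu']
    ring
  have hV'eq : ∀ t ∈ Icc a b, V' t = -2 * ‖A (u t)‖ ^ 2 + 2 * ⟪A (u t), f t⟫ := by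
    intro t ht
    have hp' : ⟪A (u t), p t⟫ = 0 := by rw [real_inner_comm]; exact hpA t ht
    simp only [hV'_def, hu' t ht, inner_add_right, inner_sub_right, hp', real_inner_self_eq_norm_sq]
    ring
  -- the energy inequality
  have hlow : ∀ t ∈ Icc a b, 0 < E t → -((2 + K₁) * V t + (K₁ + 2 * K₂) * E t) ≤ E' t := by
    intro t ht _
    rw [hE'eq t ht]
    have hIU : -(‖(u t : H)‖ * ‖f t‖) ≤ ⟪(u t : H), f t⟫ :=
      (abs_le.1 (abs_real_inner_le_norm _ _)).1
    exact low_aux (V := V t) hK₁ (norm_nonneg _) (Real.sq_sqrt (hV0 t ht)) (hf t ht) hIU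
  -- the Dirichlet-quotient law
  have hquot : ∀ t ∈ Icc a b, 0 < E t →
      V' t * E t - V t * E' t ≤ (K₁ ^ 2 + K₂ ^ 2) * (V t + E t) * E t := by
    intro t ht hEt
    rw [hV'eq t ht, hE'eq t ht]
    set Λ : ℝ := V t / E t with hΛ_def
    have hΛ : Λ * E t = V t := div_mul_cancel₀ _ hEt.ne'
    set z : H := A (u t) - Λ • (u t : H) with hz_def
    have hm2 : ‖z‖ ^ 2 = ‖A (u t)‖ ^ 2 - 2 * Λ * V t + Λ ^ 2 * E t := by
      rw [hz_def, norm_sub_sq_real, real_inner_smul_right, norm_smul, mul_pow, Real.norm_eq_abs,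
        sq_abs]
      ring
    have hj : ⟪z, f t⟫ = ⟪A (u t), f t⟫ - Λ * ⟪(u t : H), f t⟫ := by
      rw [hz_def, inner_sub_left, real_inner_smul_left]
    exact quot_aux hEt hΛ hm2 hj (real_inner_le_norm _ _) (norm_nonneg _) (hf t ht)
      (Real.sq_sqrt (hV0 t ht)) rfl (hV0 t ht)
  have hEb : E b = 0 := by simp [hE_def, hb]
  have hmain : E t₀ = 0 :=
    eq_zero_of_dirichletQuotient_law hE hV hE0 hV0 (by positivity) (by linarith) hlow hquot hEb ht₀
  have h1 : ‖(u t₀ : H)‖ = 0 := by simpa [hE_def] using hmain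
  exact (Submodule.coe_eq_zero).1 (norm_eq_zero.1 h1)

/-- **Kukavica 2007, Theorem 2.1 (classical case `α = β = 0`, `β₀ = 1`) = the log-convexity
backward uniqueness theorem of Bardos–Tartar 1973 (Thm. II.1) / Ghidaglia 1986 / Temam 1997,
Ch. III Lemma 6.2.** Let `H` be a real inner-product space, `A` a symmetric operator with domain
`D ⊆ H` and `(Ax, x) ≥ 0` on `D`; let `u : [a, b] → D` be differentiable as an `H`-valued map
(one-sided at the end points) with `t ↦ Au(t)` continuous, solving `u' + Au = f` with
`‖f(t)‖ ≤ K₁‖A^{1/2}u(t)‖ + K₂‖u(t)‖`, `‖A^{1/2}v‖ := (Av, v)^{1/2}`, `K₁ ≥ 0`. Then `u(b) = 0`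
implies `u(t) = 0` for all `t ∈ [a, b]` (printed on `[T₀, 0]`).
[cite: Kukavica2007, §2 Thm. 2.1 (p. 2417), classical case] -/
theorem eq_zero_of_abstractParabolic_backward {D : Submodule ℝ H} (A : D →ₗ[ℝ] H)
    (hsym : ∀ x y : D, ⟪A x, (y : H)⟫ = ⟪(x : H), A y⟫) (hpos : ∀ x : D, 0 ≤ ⟪A x, (x : H)⟫)
    {a b K₁ K₂ : ℝ} (hK₁ : 0 ≤ K₁) {u : ℝ → D} {u' f : ℝ → H}
    (hu : ∀ t ∈ Icc a b, HasDerivWithinAt (fun τ => (u τ : H)) (u' t) (Icc a b) t)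
    (hAu : ContinuousOn (fun t => A (u t)) (Icc a b))
    (heq : ∀ t ∈ Icc a b, u' t + A (u t) = f t)
    (hf : ∀ t ∈ Icc a b, ‖f t‖ ≤ K₁ * Real.sqrt ⟪A (u t), (u t : H)⟫ + K₂ * ‖(u t : H)‖)
    (hb : u b = 0) : ∀ t ∈ Icc a b, u t = 0 := fun _ ht =>
  eq_zero_of_abstractParabolic_backward_of_orthogonal A hsym hpos hK₁ (p := fun _ => 0) hu hAu
    (fun s hs => by rw [heq s hs, add_zero]) hf (fun _ _ => inner_zero_left _)
    (fun _ _ => inner_zero_left _) hb ht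

/-- **Ghidaglia's squared form of the hypothesis** (Kukavica 2007, p. 2415: "the most general known
situation for the backward uniqueness property is `‖f‖² ≤ K(Au, u) + K‖u‖²`"): under the
hypotheses of `eq_zero_of_abstractParabolic_backward` with (1) replaced by
`‖f(t)‖² ≤ K(⟪Au(t), u(t)⟫ + ‖u(t)‖²)`, `u(b) = 0` implies `u ≡ 0` on `[a, b]`
(`√(K(V + E)) ≤ √K·√V + √K·‖u‖`). [cite: Kukavica2007, §1 (p. 2415) with §2 Thm. 2.1] -/
theorem eq_zero_of_abstractParabolic_backward_of_sq {D : Submodule ℝ H} (A : D →ₗ[ℝ] H)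
    (hsym : ∀ x y : D, ⟪A x, (y : H)⟫ = ⟪(x : H), A y⟫) (hpos : ∀ x : D, 0 ≤ ⟪A x, (x : H)⟫)
    {a b K : ℝ} {u : ℝ → D} {u' f : ℝ → H}
    (hu : ∀ t ∈ Icc a b, HasDerivWithinAt (fun τ => (u τ : H)) (u' t) (Icc a b) t)
    (hAu : ContinuousOn (fun t => A (u t)) (Icc a b))
    (heq : ∀ t ∈ Icc a b, u' t + A (u t) = f t)
    (hf : ∀ t ∈ Icc a b, ‖f t‖ ^ 2 ≤ K * (⟪A (u t), (u t : H)⟫ + ‖(u t : H)‖ ^ 2))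
    (hb : u b = 0) : ∀ t ∈ Icc a b, u t = 0 := by
  have hK : ∀ t ∈ Icc a b, f t ≠ 0 → 0 ≤ K := by
    intro t ht hft
    have h1 : 0 < ‖f t‖ ^ 2 := by positivity
    have h2 : 0 ≤ ⟪A (u t), (u t : H)⟫ + ‖(u t : H)‖ ^ 2 :=
      add_nonneg (hpos (u t)) (sq_nonneg _)
    by_contra hneg
    have : K * (⟪A (u t), (u t : H)⟫ + ‖(u t : H)‖ ^ 2) ≤ 0 :=
      mul_nonpos_of_nonpos_of_nonneg (le_of_not_ge hneg) h2
    linarith [hf t ht]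
  refine eq_zero_of_abstractParabolic_backward A hsym hpos (K₁ := Real.sqrt K) (K₂ := Real.sqrt K)
    (Real.sqrt_nonneg K) hu hAu heq (fun t ht => ?_) hb
  by_cases hft : f t = 0
  · rw [hft, norm_zero]
    exact add_nonneg (mul_nonneg (Real.sqrt_nonneg _) (Real.sqrt_nonneg _))
      (mul_nonneg (Real.sqrt_nonneg _) (norm_nonneg _))
  have hK0 : 0 ≤ K := hK t ht hft
  have hV0 : 0 ≤ ⟪A (u t), (u t : H)⟫ := hpos (u t)
  set s := Real.sqrt ⟪A (u t), (u t : H)⟫ with hs_def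
  set n := ‖(u t : H)‖ with hn_def
  set k := Real.sqrt K with hk_def
  have hs0 : 0 ≤ s := Real.sqrt_nonneg _
  have hn0 : 0 ≤ n := norm_nonneg _
  have hs2 : s ^ 2 = ⟪A (u t), (u t : H)⟫ := Real.sq_sqrt hV0
  have hk2 : k ^ 2 = K := Real.sq_sqrt hK0
  have hrhs : 0 ≤ k * s + k * n := by positivity
  have hsq : ‖f t‖ ^ 2 ≤ (k * s + k * n) ^ 2 := by
    calc ‖f t‖ ^ 2 ≤ K * (s ^ 2 + n ^ 2) := by rw [hs2, hn_def]; exact hf t ht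
      _ ≤ (k * s + k * n) ^ 2 := by
          rw [← hk2]
          nlinarith [mul_nonneg (mul_self_nonneg k) (mul_nonneg hs0 hn0)]
  exact (pow_le_pow_iff_left₀ (norm_nonneg (f t)) hrhs two_ne_zero).1 hsq

/-- **Two solutions that coincide at the final time coincide before** (Temam 1997, Ch. III §6.2,
(6.16)–(6.17): `w = u - v`, `dw/dt + Aw = h = G(v) - G(u)`, `|h| ≤ k‖w‖`; Kukavica 2007, Thm. 2.1
applied to the difference). Let `u₁, u₂ : [a, b] → D` be `H`-differentiable with `Auᵢ` continuous,
`uᵢ' + Auᵢ = gᵢ`, and suppose `g₁ - g₂ = f + p` with `‖f‖ ≤ K₁⟪Aw, w⟫^{1/2} + K₂‖w‖` and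
`p ⟂ w`, `p ⟂ Aw` along `w = u₁ - u₂`. If `u₁(b) = u₂(b)` then `u₁ = u₂` on `[a, b]`.
[cite: Temam1997, Ch. III §6.2, (6.16)–(6.17) (p. 173)] -/
theorem eq_of_abstractParabolic_backward {D : Submodule ℝ H} (A : D →ₗ[ℝ] H)
    (hsym : ∀ x y : D, ⟪A x, (y : H)⟫ = ⟪(x : H), A y⟫) (hpos : ∀ x : D, 0 ≤ ⟪A x, (x : H)⟫)
    {a b K₁ K₂ : ℝ} (hK₁ : 0 ≤ K₁) {u₁ u₂ : ℝ → D} {u₁' u₂' g₁ g₂ f p : ℝ → H}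
    (hu₁ : ∀ t ∈ Icc a b, HasDerivWithinAt (fun τ => (u₁ τ : H)) (u₁' t) (Icc a b) t)
    (hu₂ : ∀ t ∈ Icc a b, HasDerivWithinAt (fun τ => (u₂ τ : H)) (u₂' t) (Icc a b) t)
    (hAu₁ : ContinuousOn (fun t => A (u₁ t)) (Icc a b))
    (hAu₂ : ContinuousOn (fun t => A (u₂ t)) (Icc a b))
    (heq₁ : ∀ t ∈ Icc a b, u₁' t + A (u₁ t) = g₁ t)
    (heq₂ : ∀ t ∈ Icc a b, u₂' t + A (u₂ t) = g₂ t)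
    (hg : ∀ t ∈ Icc a b, g₁ t - g₂ t = f t + p t)
    (hf : ∀ t ∈ Icc a b, ‖f t‖ ≤
      K₁ * Real.sqrt ⟪A (u₁ t - u₂ t), ((u₁ t - u₂ t : D) : H)⟫ + K₂ * ‖((u₁ t - u₂ t : D) : H)‖)
    (hpu : ∀ t ∈ Icc a b, ⟪p t, ((u₁ t - u₂ t : D) : H)⟫ = 0)
    (hpA : ∀ t ∈ Icc a b, ⟪p t, A (u₁ t - u₂ t)⟫ = 0)
    (hb : u₁ b = u₂ b) : ∀ t ∈ Icc a b, u₁ t = u₂ t := by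
  intro t ht
  have hw : ∀ s ∈ Icc a b,
      HasDerivWithinAt (fun τ => ((u₁ τ - u₂ τ : D) : H)) (u₁' s - u₂' s) (Icc a b) s := by
    intro s hs
    have h := (hu₁ s hs).sub (hu₂ s hs)
    refine h.congr (fun τ _ => ?_) ?_ <;> simp
  have hAw : ContinuousOn (fun s => A (u₁ s - u₂ s)) (Icc a b) := by
    have h := hAu₁.sub hAu₂
    refine h.congr fun s _ => ?_
    simp only [map_sub, Pi.sub_apply]
  have heq : ∀ s ∈ Icc a b, (u₁' s - u₂' s) + A (u₁ s - u₂ s) = f s + p s := by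
    intro s hs
    rw [← hg s hs, ← heq₁ s hs, ← heq₂ s hs, map_sub]; abel
  have hwb : u₁ b - u₂ b = 0 := sub_eq_zero.2 hb
  exact sub_eq_zero.1 (eq_zero_of_abstractParabolic_backward_of_orthogonal A hsym hpos hK₁ hw hAw
    heq hf hpu hpA hwb ht)

/-- **No extinction in finite time** (the forward reading of Theorem 2.1; Temam 1997, Ch. III
Lemma 6.2 read as "`w(t₀) ≠ 0 ⇒ w(t) ≠ 0` for `t ≥ t₀`"): under the hypotheses of
`eq_zero_of_abstractParabolic_backward` on `[a, b]`, if `u(t₀) ≠ 0` then `u(t) ≠ 0` for every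
`t ∈ [t₀, b]` (apply the theorem on `[a, t]`). [cite: Kukavica2007, §2 Thm. 2.1 (p. 2417), classical case] -/
theorem ne_zero_of_abstractParabolic {D : Submodule ℝ H} (A : D →ₗ[ℝ] H)
    (hsym : ∀ x y : D, ⟪A x, (y : H)⟫ = ⟪(x : H), A y⟫) (hpos : ∀ x : D, 0 ≤ ⟪A x, (x : H)⟫)
    {a b K₁ K₂ : ℝ} (hK₁ : 0 ≤ K₁) {u : ℝ → D} {u' f : ℝ → H}
    (hu : ∀ t ∈ Icc a b, HasDerivWithinAt (fun τ => (u τ : H)) (u' t) (Icc a b) t)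
    (hAu : ContinuousOn (fun t => A (u t)) (Icc a b))
    (heq : ∀ t ∈ Icc a b, u' t + A (u t) = f t)
    (hf : ∀ t ∈ Icc a b, ‖f t‖ ≤ K₁ * Real.sqrt ⟪A (u t), (u t : H)⟫ + K₂ * ‖(u t : H)‖)
    {t₀ : ℝ} (ht₀ : t₀ ∈ Icc a b) (h0 : u t₀ ≠ 0) {t : ℝ} (ht : t ∈ Icc a b) (ht₀t : t₀ ≤ t) :
    u t ≠ 0 := by
  intro hut
  have hsub : Icc a t ⊆ Icc a b := Icc_subset_Icc le_rfl ht.2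
  exact h0 (eq_zero_of_abstractParabolic_backward A hsym hpos hK₁ (a := a) (b := t)
    (fun s hs => (hu s (hsub hs)).mono hsub) (hAu.mono hsub) (fun s hs => heq s (hsub hs))
    (fun s hs => hf s (hsub hs)) hut t₀ ⟨ht₀.1, ht₀t⟩)

end Literature.Analysis.ODE

end
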